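import Mathlib
import HarnessLib
import Summits.CriticalPhenomena.Ising3DConformalLimit.Theses.HarmonicMomentsIsotropy
import Summits.CriticalPhenomena.Ising3DConformalLimit.Theorems.HarmonicMomentsIsotropyHarmonicDilutionK4Hierarchy

/-!
# Crux `AngularHierarchy` (stmt-CriticalPhenomena-6031) — birth skeleton: the increment-kernel line

Route `HarmonicMomentsIsotropy`, crux rank 2.  `AngularHierarchy` (AH) asks, inductively in the total
degree `q = n + 2m`, for the contraction `|k(β₂) - k(β₁)| ≤ (θ·sup_[β₁,β₂]|a| + ε)·(M_q(β₂) - M_q(β₁))`,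
`θ < 1`, of the `β`-increments of every harmonic moment `k_{Y,m}(β) = ∑_x Y(x)|x|^{2m}⟨σ₀σ_x⟩^∅_β`
against those of the isotropic moment `M_q(β) = ∑_x |x|^q⟨σ₀σ_x⟩^∅_β` of the subcritical free
two-point function on `ℤ³`.

The card's mechanism ("harmonic polynomials see through convolutions"; the informal item text: *"a = k/M
relaxes toward a_D = Δk/ΔM at the divergent rate ΔM/M, so AH says a_D ≤ θa + ε"*) lives on the
INCREMENT KERNEL of the `β`-flow,
`D_β(x) := ∑_{u ∈ ℤ³} ∑_{i<3} (⟨σ_uσ_{u+eᵢ} σ₀σ_x⟩^∅_β - ⟨σ_uσ_{u+eᵢ}⟩^∅_β ⟨σ₀σ_x⟩^∅_β) ≥ 0`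
(each nearest-neighbour bond of `ℤ³` once; GKS II), the infinite-volume form of the tree's
`hasDerivAt_isingTwoPoint_free` (`d/dβ ⟨σ_vσ_y⟩_Λ = ∑_{e ∈ ℰ_Λ} (⟨σ_eσ_vσ_y⟩ - ⟨σ_e⟩⟨σ_vσ_y⟩)`,
Friedli–Velenik Ex. 3.13).  With `kD_{Y,m}(β) = ∑_x Y(x)|x|^{2m}D_β(x)`, `MD_q(β) = ∑_x |x|^q D_β(x)`
the line has three named stubs:

* `stub_momentFlow` (size L; regularity of the `β`-flow of moments below `β_c`): on some
  `[βr, β_c)` the kernel moments `kD_{Y,m}`, `MD_q` are continuous in `β`, `MD_q ≥ 0`, and the moment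
  increments are their integrals, `k(β₂) - k(β₁) = ∫_{β₁}^{β₂} kD`, `M_q(β₂) - M_q(β₁) = ∫_{β₁}^{β₂} MD_q`
  (finite-volume FTC + Lebowitz domination `0 ≤ ⟨σ_e;σ₀σ_x⟩ ≤ 2(GG + GG)` + exponential decay below
  `β_c` + continuity of the unique subcritical state in `β`; no infinite-volume differentiability
  is asserted).
* `stub_kernelContractionK4` (size XL; THE DECISIVE FIRST INSTANCE, the card's `a_D ≤ θ a + ε` for the
  cubic harmonic `K₄ = ∑xᵢ⁴ - (3/5)|x|⁴` at every radial order `m`, given the lower ratios → 0; at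
  `m = 0` the hypothesis is dischargeable, `lowerRatios_below_four`, so it is unconditional there):
  `∃θ<1 ∀ε>0 ∃β₀<β_c ∀β ∈ [β₀,β_c): |kD_{K₄,m}(β)| ≤ (θ|a_{K₄,m}(β)| + ε)·MD_{4+2m}(β)`.
* `stub_kernelContractionInvariant` (size XL): the same kernel inequality for the `B₃`-invariant
  harmonic homogeneous `Y` of even degree `n ≥ 6` (`K₆, K₈, …`), given the lower ratios → 0.

`AngularHierarchy_of` (sorry-free): an abstract real-analysis lemma
(`increment_contraction_of_kernel`: flow representation + continuous nonnegative kernel + pointwise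
kernel bound ⟹ the integrated contraction with `max θ 0`, by `|∫kD| ≤ ∫|kD| ≤ (θ'·sup|a| + ε)∫MD`),
then the tree's Reynolds/quartic reduction `angularHierarchy_iff_K4_and_invariant_six_le`
(`HarmonicMomentsIsotropyHarmonicDilutionK4Hierarchy.lean`: off the invariant sector `k ≡ 0`; in
degree 4 every harmonic moment is a multiple of the `K₄` one) and `contraction_transfer`.

Why the cut is honest: the kernel stubs are the crux in the language where its mechanism is stated
(transport vs. source of harmonic content of `D_β = ∑_b ⟨σ_b;σ₀σ_x⟩`, near-field / far-field bond split of the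
route's two-layer plan attach to `kD`), not a rewording: passing between the kernel and the increment
forms costs exactly `stub_momentFlow` plus the integration lemma below, and neither kernel stub alone
reaches AH (the quartic and the degree-≥6 invariant sectors are both needed).  Disproof.lean for this
crux: none on file (no `_false_without_` obstruction to honour yet); negatives index of the summit: no
statement about these moments.
-/

namespace Summit.CriticalPhenomena.Ising3DConformalLimit.Cruxes.AngularHierarchy.Birth

open Filter Topology Set MeasureTheory
open Literature.Probability.LatticeModels
open Summit.CriticalPhenomena.Ising3DConformalLimit.Theses.HarmonicMomentsIsotropy
open Summit.CriticalPhenomena.Ising3DConformalLimit.Theorems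

/-! ### §0 Glue lemma: from a pointwise kernel bound to the contraction of increments -/

/-- **Integration lemma (the only analysis in the assembly).**  If `k` and `M` have the flow
representation `k(β₂) - k(β₁) = ∫_{β₁}^{β₂} kD`, `M(β₂) - M(β₁) = ∫_{β₁}^{β₂} MD` on `[βr, βc)` with
`kD`, `MD` continuous there, `MD ≥ 0`, `|k/M| ≤ C`, and the kernel bound
`|kD(β)| ≤ (θ|k(β)/M(β)| + ε)·MD(β)` holds on a left neighbourhood of `βc` for every `ε > 0`, then the
increments of `k` are contracted against those of `M` with factor `max θ 0`. -/
theorem increment_contraction_of_kernel (k M kD MD : ℝ → ℝ) {βc βr θ C : ℝ} (hβr : βr < βc)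
    (hkflow : ∀ β₁ β₂ : ℝ, βr ≤ β₁ → β₁ ≤ β₂ → β₂ < βc → k β₂ - k β₁ = ∫ β in β₁..β₂, kD β)
    (hMflow : ∀ β₁ β₂ : ℝ, βr ≤ β₁ → β₁ ≤ β₂ → β₂ < βc → M β₂ - M β₁ = ∫ β in β₁..β₂, MD β)
    (hkD : ContinuousOn kD (Set.Ico βr βc)) (hMD : ContinuousOn MD (Set.Ico βr βc))
    (hMD0 : ∀ β : ℝ, βr ≤ β → β < βc → 0 ≤ MD β)
    (hC : ∀ β : ℝ, βr ≤ β → β < βc → |k β / M β| ≤ C)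
    (hker : ∀ ε : ℝ, 0 < ε → ∃ β₀ : ℝ, β₀ < βc ∧ ∀ β : ℝ, β₀ ≤ β → β < βc →
      |kD β| ≤ (θ * |k β / M β| + ε) * MD β) :
    ∀ ε : ℝ, 0 < ε → ∃ β₀ : ℝ, β₀ < βc ∧ ∀ β₁ β₂ : ℝ, β₀ ≤ β₁ → β₁ < β₂ → β₂ < βc →
      |k β₂ - k β₁| ≤
        (max θ 0 * sSup ((fun β => |k β / M β|) '' Set.Icc β₁ β₂) + ε) * (M β₂ - M β₁) := by
  intro ε hε
  obtain ⟨β₀, hβ₀, hK⟩ := hker ε hε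
  refine ⟨max β₀ βr, max_lt hβ₀ hβr, fun β₁ β₂ h₁ h₁₂ h₂ => ?_⟩
  have h₀₁ : β₀ ≤ β₁ := (le_max_left _ _).trans h₁
  have hr₁ : βr ≤ β₁ := (le_max_right _ _).trans h₁
  have hbdd : BddAbove ((fun β => |k β / M β|) '' Set.Icc β₁ β₂) := by
    refine ⟨C, ?_⟩
    rintro _ ⟨β, hβ, rfl⟩
    exact hC β (hr₁.trans hβ.1) (hβ.2.trans_lt h₂)
  have hleS : ∀ β ∈ Set.Icc β₁ β₂,
      |k β / M β| ≤ sSup ((fun β => |k β / M β|) '' Set.Icc β₁ β₂) := fun β hβ =>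
    le_csSup hbdd ⟨β, hβ, rfl⟩
  set S : ℝ := sSup ((fun β => |k β / M β|) '' Set.Icc β₁ β₂) with hS
  set θ' : ℝ := max θ 0 with hθ'
  have hθ'0 : 0 ≤ θ' := le_max_right _ _
  have hθθ' : θ ≤ θ' := le_max_left _ _
  -- the pointwise kernel bound on `[β₁, β₂]`, with `sup |a|` in place of `|a(β)|`
  have hpt : ∀ β ∈ Set.Icc β₁ β₂, |kD β| ≤ (θ' * S + ε) * MD β := by
    intro β hβ
    have hβr' : βr ≤ β := hr₁.trans hβ.1
    have hβc' : β < βc := hβ.2.trans_lt h₂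
    have hMDβ : 0 ≤ MD β := hMD0 β hβr' hβc'
    have h2 : θ * |k β / M β| ≤ θ' * S :=
      calc θ * |k β / M β| ≤ θ' * |k β / M β| :=
            mul_le_mul_of_nonneg_right hθθ' (abs_nonneg _)
        _ ≤ θ' * S := mul_le_mul_of_nonneg_left (hleS β hβ) hθ'0
    calc |kD β| ≤ (θ * |k β / M β| + ε) * MD β := hK β (h₀₁.trans hβ.1) hβc'
      _ ≤ (θ' * S + ε) * MD β := mul_le_mul_of_nonneg_right (by linarith) hMDβ
  -- integrability on `[β₁, β₂] ⊆ [βr, βc)`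
  have hsub : Set.Icc β₁ β₂ ⊆ Set.Ico βr βc := fun β hβ => ⟨hr₁.trans hβ.1, hβ.2.trans_lt h₂⟩
  have hkDi : IntervalIntegrable kD volume β₁ β₂ :=
    ContinuousOn.intervalIntegrable_of_Icc h₁₂.le (hkD.mono hsub)
  have hMDi : IntervalIntegrable MD volume β₁ β₂ :=
    ContinuousOn.intervalIntegrable_of_Icc h₁₂.le (hMD.mono hsub)
  rw [hkflow β₁ β₂ hr₁ h₁₂.le h₂, hMflow β₁ β₂ hr₁ h₁₂.le h₂]
  calc |∫ β in β₁..β₂, kD β| ≤ ∫ β in β₁..β₂, |kD β| :=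
        intervalIntegral.abs_integral_le_integral_abs h₁₂.le
    _ ≤ ∫ β in β₁..β₂, (θ' * S + ε) * MD β :=
        intervalIntegral.integral_mono_on h₁₂.le hkDi.abs (hMDi.const_mul _) hpt
    _ = (θ' * S + ε) * ∫ β in β₁..β₂, MD β := intervalIntegral.integral_const_mul _ _

/-! ### §1 The stub statements, as named propositions -/

/-- **Statement of stub 1 — flow representation and regularity of the moments below `β_c` (size L).**
There is `0 ≤ βr < β_c(3)` such that on `[βr, β_c)`: for every homogeneous `Y` and every `m`, the
kernel moment `kD_{Y,m}(β) = ∑_x Y(x)|x|^{2m}D_β(x)` is continuous in `β` and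
`k_{Y,m}(β₂) - k_{Y,m}(β₁) = ∫_{β₁}^{β₂} kD_{Y,m}`; for every `q`, `MD_q(β) = ∑_x |x|^q D_β(x)` is
continuous, nonnegative (GKS II), and `M_q(β₂) - M_q(β₁) = ∫_{β₁}^{β₂} MD_q`.  Here
`D_β(x) = ∑_u ∑_i (⟨σ_uσ_{u+eᵢ}σ₀σ_x⟩^∅_β - ⟨σ_uσ_{u+eᵢ}⟩^∅_β⟨σ₀σ_x⟩^∅_β)` is the increment kernel of the
`β`-flow (infinite-volume form of `hasDerivAt_isingTwoPoint_free`; summable by the Lebowitz bound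
`isingExpect_cov_spinPair_le` and exponential decay below `β_c`). -/
def MomentFlow : Prop :=
    (let G : ℝ → Site 3 → ℝ := twoPointFree 3;
      let nE : Site 3 → ℝ := fun x : Site 3 => Real.sqrt (∑ i, ((x i : ℝ)) ^ 2);
      let D : ℝ → Site 3 → ℝ := fun β x => ∑' u : Site 3, ∑ i : Fin 3,
        (freeExpect 3 β 0 (fun σ => spinPair u (u + Pi.single i 1) σ * spinPair 0 x σ) -
          freeExpect 3 β 0 (spinPair u (u + Pi.single i 1)) * G β x);
      let k : MvPolynomial (Fin 3) ℝ → ℕ → ℝ → ℝ := fun Y m β =>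
        ∑' x : Site 3, MvPolynomial.eval (fun i => (x i : ℝ)) Y * nE x ^ (2 * m) * G β x;
      let M : ℕ → ℝ → ℝ := fun q β => ∑' x : Site 3, nE x ^ q * G β x;
      let kD : MvPolynomial (Fin 3) ℝ → ℕ → ℝ → ℝ := fun Y m β =>
        ∑' x : Site 3, MvPolynomial.eval (fun i => (x i : ℝ)) Y * nE x ^ (2 * m) * D β x;
      let MD : ℕ → ℝ → ℝ := fun q β => ∑' x : Site 3, nE x ^ q * D β x;
      ∃ βr : ℝ, 0 ≤ βr ∧ βr < criticalBeta 3 ∧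
        (∀ (Y : MvPolynomial (Fin 3) ℝ) (n m : ℕ), Y.IsHomogeneous n →
          ContinuousOn (fun β => kD Y m β) (Set.Ico βr (criticalBeta 3)) ∧
          ∀ β₁ β₂ : ℝ, βr ≤ β₁ → β₁ ≤ β₂ → β₂ < criticalBeta 3 →
            k Y m β₂ - k Y m β₁ = ∫ β in β₁..β₂, kD Y m β) ∧
        (∀ q : ℕ,
          ContinuousOn (fun β => MD q β) (Set.Ico βr (criticalBeta 3)) ∧
          (∀ β : ℝ, βr ≤ β → β < criticalBeta 3 → 0 ≤ MD q β) ∧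
          ∀ β₁ β₂ : ℝ, βr ≤ β₁ → β₁ ≤ β₂ → β₂ < criticalBeta 3 →
            M q β₂ - M q β₁ = ∫ β in β₁..β₂, MD q β))

/-- **Statement of stub 2 — kernel contraction for the cubic harmonic `K₄` (size XL; the decisive
instance).**  For every radial order `m`, given that all anisotropy ratios of total degree `< 4 + 2m`
tend to `0` as `β ↑ β_c` (dischargeable at `m = 0`, `lowerRatios_below_four`): the harmonic content of
the increment kernel at level `(K₄, m)` is at most `θ < 1` times the current anisotropy plus `ε`,
`|kD_{K₄,m}(β)| ≤ (θ|a_{K₄,m}(β)| + ε)·MD_{4+2m}(β)` on a left neighbourhood of `β_c` — the card's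
`a_D ≤ θ a + ε`: positive kernels do not amplify harmonics faster than the mean (Funk–Hecke) and the
energy–spin–spin vertex carries no independent `ℓ = 4` source at leading order (CPRV `ρ = 2 + η - η₄`). -/
def KernelContractionK4 : Prop :=
    (let G : ℝ → Site 3 → ℝ := twoPointFree 3;
      let nE : Site 3 → ℝ := fun x : Site 3 => Real.sqrt (∑ i, ((x i : ℝ)) ^ 2);
      let D : ℝ → Site 3 → ℝ := fun β x => ∑' u : Site 3, ∑ i : Fin 3,
        (freeExpect 3 β 0 (fun σ => spinPair u (u + Pi.single i 1) σ * spinPair 0 x σ) -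
          freeExpect 3 β 0 (spinPair u (u + Pi.single i 1)) * G β x);
      let k : MvPolynomial (Fin 3) ℝ → ℕ → ℝ → ℝ := fun Y m β =>
        ∑' x : Site 3, MvPolynomial.eval (fun i => (x i : ℝ)) Y * nE x ^ (2 * m) * G β x;
      let M : ℕ → ℝ → ℝ := fun q β => ∑' x : Site 3, nE x ^ q * G β x;
      let kD : MvPolynomial (Fin 3) ℝ → ℕ → ℝ → ℝ := fun Y m β =>
        ∑' x : Site 3, MvPolynomial.eval (fun i => (x i : ℝ)) Y * nE x ^ (2 * m) * D β x;
      let MD : ℕ → ℝ → ℝ := fun q β => ∑' x : Site 3, nE x ^ q * D β x;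
      let a : MvPolynomial (Fin 3) ℝ → ℕ → ℕ → ℝ → ℝ := fun Y n m β => k Y m β / M (n + 2 * m) β;
      let K4 : MvPolynomial (Fin 3) ℝ := ∑ i : Fin 3, MvPolynomial.X i ^ 4 -
        MvPolynomial.C (3 / 5 : ℝ) * (∑ i : Fin 3, MvPolynomial.X i ^ 2) ^ 2;
      ∀ m : ℕ, (∀ (n' m' : ℕ) (Y' : MvPolynomial (Fin 3) ℝ), 1 ≤ n' → n' + 2 * m' < 4 + 2 * m →
          Y'.IsHomogeneous n' → (∑ i : Fin 3, MvPolynomial.pderiv i (MvPolynomial.pderiv i Y')) = 0 →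
          Filter.Tendsto (fun β => a Y' n' m' β)
            (nhdsWithin (criticalBeta 3) (Set.Iio (criticalBeta 3))) (nhds 0)) →
        ∃ θ : ℝ, θ < 1 ∧ ∀ ε : ℝ, 0 < ε → ∃ β₀ : ℝ, β₀ < criticalBeta 3 ∧
          ∀ β : ℝ, β₀ ≤ β → β < criticalBeta 3 →
            |kD K4 m β| ≤ (θ * |a K4 4 m β| + ε) * MD (4 + 2 * m) β)

/-- **Statement of stub 3 — kernel contraction for the invariant harmonics of even degree `n ≥ 6`
(size XL).**  Given that all anisotropy ratios of total degree `< q` tend to `0`, every `B₃`-invariant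
harmonic homogeneous `Y` of even degree `n ≥ 6` with `n + 2m = q` satisfies the same kernel inequality
`|kD_{Y,m}(β)| ≤ (θ|a_{Y,n,m}(β)| + ε)·MD_q(β)`, `θ < 1`, on a left neighbourhood of `β_c` (the higher
cubic harmonics `K₆, K₈, K₁₀, …`; by the tree's Reynolds reduction nothing else is needed). -/
def KernelContractionInvariant : Prop :=
    (let G : ℝ → Site 3 → ℝ := twoPointFree 3;
      let nE : Site 3 → ℝ := fun x : Site 3 => Real.sqrt (∑ i, ((x i : ℝ)) ^ 2);
      let D : ℝ → Site 3 → ℝ := fun β x => ∑' u : Site 3, ∑ i : Fin 3,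
        (freeExpect 3 β 0 (fun σ => spinPair u (u + Pi.single i 1) σ * spinPair 0 x σ) -
          freeExpect 3 β 0 (spinPair u (u + Pi.single i 1)) * G β x);
      let k : MvPolynomial (Fin 3) ℝ → ℕ → ℝ → ℝ := fun Y m β =>
        ∑' x : Site 3, MvPolynomial.eval (fun i => (x i : ℝ)) Y * nE x ^ (2 * m) * G β x;
      let M : ℕ → ℝ → ℝ := fun q β => ∑' x : Site 3, nE x ^ q * G β x;
      let kD : MvPolynomial (Fin 3) ℝ → ℕ → ℝ → ℝ := fun Y m β =>
        ∑' x : Site 3, MvPolynomial.eval (fun i => (x i : ℝ)) Y * nE x ^ (2 * m) * D β x;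
      let MD : ℕ → ℝ → ℝ := fun q β => ∑' x : Site 3, nE x ^ q * D β x;
      let a : MvPolynomial (Fin 3) ℝ → ℕ → ℕ → ℝ → ℝ := fun Y n m β => k Y m β / M (n + 2 * m) β;
      ∀ q : ℕ, (∀ (n' m' : ℕ) (Y' : MvPolynomial (Fin 3) ℝ), 1 ≤ n' → n' + 2 * m' < q →
          Y'.IsHomogeneous n' → (∑ i : Fin 3, MvPolynomial.pderiv i (MvPolynomial.pderiv i Y')) = 0 →
          Filter.Tendsto (fun β => a Y' n' m' β)
            (nhdsWithin (criticalBeta 3) (Set.Iio (criticalBeta 3))) (nhds 0)) →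
        ∀ (n m : ℕ) (Y : MvPolynomial (Fin 3) ℝ), 6 ≤ n → Even n → n + 2 * m = q →
          Y.IsHomogeneous n → (∑ i : Fin 3, MvPolynomial.pderiv i (MvPolynomial.pderiv i Y)) = 0 →
          (∀ (π : Equiv.Perm (Fin 3)) (ε : Fin 3 → ℤˣ) (v : Fin 3 → ℝ),
            MvPolynomial.eval (fun i => ((ε i : ℤ) : ℝ) * v (π.symm i)) Y = MvPolynomial.eval v Y) →
          ∃ θ : ℝ, θ < 1 ∧ ∀ ε : ℝ, 0 < ε → ∃ β₀ : ℝ, β₀ < criticalBeta 3 ∧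
            ∀ β : ℝ, β₀ ≤ β → β < criticalBeta 3 →
              |kD Y m β| ≤ (θ * |a Y n m β| + ε) * MD (n + 2 * m) β)

/-! ### §2 The registered stubs (the only `sorry`s of this file) -/

/-- stub 1 (size L, provable with work): flow representation / regularity of the moments. -/
theorem stub_momentFlow : MomentFlow := by
  sorry

/-- stub 2 (size XL, the decisive first instance; HARDEST): kernel contraction for `K₄`. -/
theorem stub_kernelContractionK4 : KernelContractionK4 := by
  sorry

/-- stub 3 (size XL): kernel contraction for the invariant harmonics of even degree `≥ 6`. -/
theorem stub_kernelContractionInvariant : KernelContractionInvariant := by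
  sorry

/-! ### Name-keyed aliases of the stub statements (the hypotheses of the composition) -/
namespace Registered

/-- Alias of `MomentFlow` keyed by the registered stub name. -/
abbrev stub_momentFlow : Prop := MomentFlow
/-- Alias of `KernelContractionK4` keyed by the registered stub name. -/
abbrev stub_kernelContractionK4 : Prop := KernelContractionK4
/-- Alias of `KernelContractionInvariant` keyed by the registered stub name. -/
abbrev stub_kernelContractionInvariant : Prop := KernelContractionInvariant

end Registered

/-! ### §3 The composition: the three stubs give the crux, BY NAME -/

set_option maxHeartbeats 800000 in
/-- **`AngularHierarchy` from the increment-kernel line.**  Integrate the kernel inequalities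
along the flow representation (`increment_contraction_of_kernel`, with the a-priori bound
`abs_ratio_le`), then close with the tree's reduction of the crux to the `K₄` family and the
invariant harmonics of even degree `≥ 6` (`angularHierarchy_iff_K4_and_invariant_six_le`,
`contraction_transfer`, `eval_K4poly`).  Hypotheses = exactly the three registered stubs. -/
theorem AngularHierarchy_of (hflow : Registered.stub_momentFlow)
    (hK4 : Registered.stub_kernelContractionK4) (h6 : Registered.stub_kernelContractionInvariant) :
    Summit.CriticalPhenomena.Ising3DConformalLimit.Theses.HarmonicMomentsIsotropy.AngularHierarchy := by
  dsimp only [Registered.stub_momentFlow, Registered.stub_kernelContractionK4,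
    Registered.stub_kernelContractionInvariant, MomentFlow, KernelContractionK4,
    KernelContractionInvariant] at hflow hK4 h6
  obtain ⟨βr, hβr0, hβr, hflowk, hflowM⟩ := hflow
  have hβc : 0 < criticalBeta 3 := criticalBeta_pos_holds (by norm_num)
  refine angularHierarchy_iff_K4_and_invariant_six_le.2 ⟨fun m ih => ?_, ?_⟩
  · -- the quartic level: kernel contraction for `K₄`, integrated, then to the explicit form
    obtain ⟨θ, hθ, hker⟩ := hK4 m ih
    obtain ⟨hkD, hkfl⟩ := hflowk (∑ i : Fin 3, MvPolynomial.X i ^ 4 - MvPolynomial.C (3 / 5 : ℝ) * (∑ i : Fin 3, MvPolynomial.X i ^ 2) ^ 2 : MvPolynomial (Fin 3) ℝ) 4 m K4poly_isHomogeneous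
    obtain ⟨hMD, hMD0, hMfl⟩ := hflowM (4 + 2 * m)
    have hcontr := increment_contraction_of_kernel
      (fun β => ∑' x : Site 3, MvPolynomial.eval (fun i => (x i : ℝ)) (∑ i : Fin 3, MvPolynomial.X i ^ 4 - MvPolynomial.C (3 / 5 : ℝ) * (∑ i : Fin 3, MvPolynomial.X i ^ 2) ^ 2 : MvPolynomial (Fin 3) ℝ) * Real.sqrt (∑ i, ((x i : ℝ)) ^ 2) ^ (2 * m) * twoPointFree 3 β x)
      (fun β => ∑' x : Site 3, Real.sqrt (∑ i, ((x i : ℝ)) ^ 2) ^ (4 + 2 * m) * twoPointFree 3 β x)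
      (fun β => ∑' x : Site 3, MvPolynomial.eval (fun i => (x i : ℝ)) (∑ i : Fin 3, MvPolynomial.X i ^ 4 - MvPolynomial.C (3 / 5 : ℝ) * (∑ i : Fin 3, MvPolynomial.X i ^ 2) ^ 2 : MvPolynomial (Fin 3) ℝ) * Real.sqrt (∑ i, ((x i : ℝ)) ^ 2) ^ (2 * m) * (∑' u : Site 3, ∑ i : Fin 3, (freeExpect 3 β 0 (fun σ => spinPair u (u + Pi.single i 1) σ * spinPair 0 x σ) - freeExpect 3 β 0 (spinPair u (u + Pi.single i 1)) * twoPointFree 3 β x)))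
      (fun β => ∑' x : Site 3, Real.sqrt (∑ i, ((x i : ℝ)) ^ 2) ^ (4 + 2 * m) * (∑' u : Site 3, ∑ i : Fin 3, (freeExpect 3 β 0 (fun σ => spinPair u (u + Pi.single i 1) σ * spinPair 0 x σ) - freeExpect 3 β 0 (spinPair u (u + Pi.single i 1)) * twoPointFree 3 β x)))
      hβr hkfl hMfl hkD hMD hMD0
      (fun β hβ hβ' => abs_ratio_le (hβr0.trans hβ) hβ' _ K4poly_isHomogeneous m) hker
    refine ⟨max θ 0, max_lt hθ one_pos, ?_⟩
    refine contraction_transfer (c := 1) (θ := max θ 0)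
      (k₁ := fun β => ∑' x : Site 3, MvPolynomial.eval (fun i => (x i : ℝ)) (∑ i : Fin 3, MvPolynomial.X i ^ 4 - MvPolynomial.C (3 / 5 : ℝ) * (∑ i : Fin 3, MvPolynomial.X i ^ 2) ^ 2 : MvPolynomial (Fin 3) ℝ) * Real.sqrt (∑ i, ((x i : ℝ)) ^ 2) ^ (2 * m) * twoPointFree 3 β x)
      (k₂ := fun β => ∑' x : Site 3, ((∑ i : Fin 3, ((x i : ℤ) : ℝ) ^ 4) - 3 / 5 * (∑ i : Fin 3, ((x i : ℤ) : ℝ) ^ 2) ^ 2) * Real.sqrt (∑ i, ((x i : ℤ) : ℝ) ^ 2) ^ (2 * m) * twoPointFree 3 β x)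
      (M := fun β => ∑' x : Site 3, Real.sqrt (∑ i, ((x i : ℝ)) ^ 2) ^ (4 + 2 * m) * twoPointFree 3 β x)
      hβc (fun β _ _ => ?_) (isotropicMoment_mono (4 + 2 * m)) hcontr
    show _ = 1 * _
    rw [one_mul]
    exact tsum_congr fun x => by rw [eval_K4poly]
  · -- the invariant harmonics of even degree `≥ 6`
    intro q ih n m Y hn he hq hY hΔ hinv
    obtain ⟨θ, hθ, hker⟩ := h6 q ih n m Y hn he hq hY hΔ hinv
    obtain ⟨hkD, hkfl⟩ := hflowk Y n m hY
    obtain ⟨hMD, hMD0, hMfl⟩ := hflowM (n + 2 * m)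
    have hcontr := increment_contraction_of_kernel
      (fun β => ∑' x : Site 3, MvPolynomial.eval (fun i => (x i : ℝ)) Y * Real.sqrt (∑ i, ((x i : ℝ)) ^ 2) ^ (2 * m) * twoPointFree 3 β x)
      (fun β => ∑' x : Site 3, Real.sqrt (∑ i, ((x i : ℝ)) ^ 2) ^ (n + 2 * m) * twoPointFree 3 β x)
      (fun β => ∑' x : Site 3, MvPolynomial.eval (fun i => (x i : ℝ)) Y * Real.sqrt (∑ i, ((x i : ℝ)) ^ 2) ^ (2 * m) * (∑' u : Site 3, ∑ i : Fin 3, (freeExpect 3 β 0 (fun σ => spinPair u (u + Pi.single i 1) σ * spinPair 0 x σ) - freeExpect 3 β 0 (spinPair u (u + Pi.single i 1)) * twoPointFree 3 β x)))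
      (fun β => ∑' x : Site 3, Real.sqrt (∑ i, ((x i : ℝ)) ^ 2) ^ (n + 2 * m) * (∑' u : Site 3, ∑ i : Fin 3, (freeExpect 3 β 0 (fun σ => spinPair u (u + Pi.single i 1) σ * spinPair 0 x σ) - freeExpect 3 β 0 (spinPair u (u + Pi.single i 1)) * twoPointFree 3 β x)))
      hβr hkfl hMfl hkD hMD hMD0
      (fun β hβ hβ' => abs_ratio_le (hβr0.trans hβ) hβ' Y hY m) hker
    exact ⟨max θ 0, max_lt hθ one_pos, hcontr⟩

/-- The crux from the registered stubs plugged in (closed modulo exactly `stub_momentFlow`,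
`stub_kernelContractionK4`, `stub_kernelContractionInvariant`: the file's only `sorry`s feed it). -/
theorem AngularHierarchy_proof :
    Summit.CriticalPhenomena.Ising3DConformalLimit.Theses.HarmonicMomentsIsotropy.AngularHierarchy :=
  AngularHierarchy_of stub_momentFlow stub_kernelContractionK4 stub_kernelContractionInvariant

end Summit.CriticalPhenomena.Ising3DConformalLimit.Cruxes.AngularHierarchy.Birth
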